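import Mathlib

/-!
# Conjecture N (hodge-weil ladder, GAPS G51b), format (5,3): CROSS + TWO FREE E-ROOTS — the exit `Δ = 0`, part A1 (slice `t^1`, sub-sliced by powers of `m`) — sub-file 3 of 3: `sub_1_9`, `sub_1_10`

Split for the tree by prover 2, generation 28 (note `run/shared/lean/b2b/hodge-weil/b2b-hweil-pv2-g28/DC2-CLOSED-G28.md` §6): pv2-g24's staged part is cut into
modules of at most 4 `ring` identities each (one sub-slice ≈ 65 s on the farm; the one-file part exceeds the elaboration window); statements byte-identical to the staged ones.

Prover 2, generation 24 (note `run/shared/lean/b2b/hodge-weil/b2b-hweil-pv2-g24/CROSSPLUS3-G24.md` §2.3). On the piece `{h_p = 0}` of the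
'cross + two free E-roots' stratum (charge-gap coordinates `(m,t,a1,a2,u1,u2)`, `b_i = a_i − t + u_i`; pv2-g23 §3): `G = 4mN/(XΔ)`, `h_m = −m²H/(X²Δ³)`,
`Δ = Π − m t`, `Π = m² + 2m(a1+a2) + 2a1a2`. The t-endpoint reduction of the piece exits the feasible set where `Δ = 0`; there
`m³H = Δ·Q_H + 8X·F³·((m+a2)L₁ + (m+a1)L₂)` (`L_i = m(a_i+u_i) − Π`, `F = a1a2(u1+u2) + a1 m u1 + a2 m u2`), which is proved here SLICE BY SLICE
(a single `ring` over the 716-term `H` does not fit the farm's elaboration window): `H = Σ_j tʲH_j`, `Q_H = Σ_j tʲq_j`, and for the large slices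
`j ≤ 2` also `H_j = Σ_k mᵏH_{j,k}`, `q_j = Σ_k mᵏq_{j,k}`, so that every `ring` runs over polynomials in `(a1,a2,u1,u2)`.
This file: the sub-slice identities `sub_j_e` (`ring`) and the assembled slice identities `slice0`, `slice1`, `slice2`; `q2_msplit` links the flat `q₂` of part B.
Pure real algebra; nothing here is a case of HC, a rung or a door edge; no statement of Markman's papers is used. New cell result ⇒ Summits/.
-/

set_option linter.dupNamespace false
set_option maxRecDepth 16384

namespace Summit.HodgeConjecture.HodgeConjecture.WeilClassTestFormatFiveThreeCrossPlusTwoFaceDeltaSlicesA1Sub3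

set_option maxHeartbeats 4000000 in
/-- sub-slice `m^9` of slice `t^1` (`ring` over `ℚ[a1,a2,u1,u2]`). -/
theorem sub_1_9 (a1 a2 u1 u2 : ℝ) :
    (-6*a1*u1^2 - 8*a1*u2^2 - 8*a2*u1^2 - 6*a2*u2^2 - 4*u1^3 - u1^2*u2 - u1*u2^2 - 4*u2^3 : ℝ) = (-4*a1*u1^2 - 6*a1*u2^2 - 6*a2*u1^2 - 4*a2*u2^2 - 3*u1^3 - u1^2*u2 - u1*u2^2 - 3*u2^3) + (2*a1 + 2*a2) * (-u1^2 - u2^2) - (u1^3 + u2^3) := by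
  ring

set_option maxHeartbeats 4000000 in
/-- sub-slice `m^10` of slice `t^1` (`ring` over `ℚ[a1,a2,u1,u2]`). -/
theorem sub_1_10 (_a1 _a2 u1 u2 : ℝ) :
    (-u1^2 - u2^2 : ℝ) = (-u1^2 - u2^2) := by
  ring

end Summit.HodgeConjecture.HodgeConjecture.WeilClassTestFormatFiveThreeCrossPlusTwoFaceDeltaSlicesA1Sub3
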